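import Summits.CriticalPhenomena.PercolationContinuityZ3.Theses.PercNearOneGluing
import Literature.Probability.Percolation.PercolationEvents
import HarnessLib.Audit
import Literature.Probability.LatticeModels.ProdBernoulliIndependence
import Summits.CriticalPhenomena.PercolationContinuityZ3.Theorems.PercNearOneGluingAdditiveGluingGlueReach
import Summits.CriticalPhenomena.PercolationContinuityZ3.Theorems.PercNearOneGluingAdditiveGluingGluePushforward
import Summits.CriticalPhenomena.PercolationContinuityZ3.Theorems.PercNearOneGluingAdditiveGluingSetObserverLemma3

/-! TTRL-lite variant V2456 of stmt-CriticalPhenomena-4574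

(`stub_shorteningStep` of line `kn_shortening_induction`, move `specialise+small_case`: `n := 5`
and `A.card ≤ 2`).  This is Kozma–Nitzan's Conjecture 6 (arXiv:2401.12397 §5.3, the shortening
step measured against the OLD minimiser `a₀`) for at most two relays, and it is proved here by a
genuine argument (the induction hypothesis is not used):

* Harris (`prodBernoulli_harris`) in the glued measure `μ = P_{w[s(v,x) ↦ 1]}`:
  `μ(v ↔ A) μ(a₀ ↔ b) ≤ μ({v ↔ A} ∩ {a₀ ↔ b})`;
* pointwise, `{v ↔ A} ∩ {a₀ ↔ b} ⊆ ({v ↔ b} ∩ {v ↔ a₀}) ∪ T` with the exchange event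
  `T = {v ↔ a₁, v ↮ a₀, a₀ ↔ b}` (`a₁` the other relay), so it remains to show
  `μ(T) ≤ μ({v ↔ b} ∖ {v ↔ a₀})`;
* gluing is a push-forward (`stub_gluePushforward`, `stub_glueReach` with `S = {v, x}`): under
  `ω ↦ ω ∪ {s(v,x)}` the glued cluster of `v` is `K(ω) = C(v) ∪ C(x)` and, off `{a₀ ∈ K}`, the
  event `{a₀ ↔ b}` is unchanged; hence `μ(T) = P_w({a₀ ↔ b} ∩ Q)` and
  `μ({v ↔ b} ∖ {v ↔ a₀}) ≥ P_w({a₁ ↔ b} ∩ Q)` with `Q = {a₁ ∈ K, a₀ ∉ K}`;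
* `Q` is the lower end of the sandwich of the observer SET `{v, x}`, so Kozma–Nitzan's Lemma 3
  for set-observer sandwich events (`stub_lemma3SandwichSet_sp`, van den Berg–Häggström–Kahn)
  and the minimality `P_w(a₀ ↔ b) ≤ P_w(a₁ ↔ b)` give `P_w({a₀ ↔ b} ∩ Q) ≤ P_w({a₁ ↔ b} ∩ Q)`.

No new definitions, no named facts. -/

namespace Summit.CriticalPhenomena.PercolationContinuityZ3.Theorems

open MeasureTheory Set Literature.Probability.LatticeModels Literature.Probability.Percolation
open scoped Classical BigOperators

/-- TTRL-lite variant V2456 of `stub_shorteningStep` (stmt-CriticalPhenomena-4574, Kozma–Nitzan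
Conjecture 6 with induction hypothesis) on `Fin 5` with `A.card ≤ 2`: in the contracted weights
`w[s(v,x) ↦ 1]`, `P(v ↔ A) · P(a₀ ↔ b) ≤ P(v ↔ b)` for the old minimiser `a₀`.  Proof: Harris,
the exchange event `{v ↔ a₁, v ↮ a₀, a₀ ↔ b}`, transport to `P_w` along the gluing push-forward,
and Kozma–Nitzan's Lemma 3 for the sandwich event `{a₁ ∈ K, a₀ ∉ K}` of the observer set
`{v, x}` (`K = C(v) ∪ C(x)`). -/
theorem stub_shorteningStep_var2456 : ∀ (w : Sym2 (Fin 5) → unitInterval) (A : Finset (Fin 5)) (b v x a₀ : Fin 5), A.card ≤ 2 → v ∉ A → v ≠ x → w s(v, x) = 0 → a₀ ∈ A → (∀ a ∈ A, (prodBernoulli w).real (openConn a₀ b) ≤ (prodBernoulli w).real (openConn a b)) → (∀ w' : Sym2 (Fin 5) → unitInterval, (∀ e, w e = 0 → w' e = 0) → ∀ (A' : Finset (Fin 5)) (o' b' : Fin 5) (t : ℝ), (∀ a ∈ A', t ≤ (prodBernoulli w').real (openConn a b')) → (prodBernoulli w').real (⋃ a ∈ A', openConn o' a) * t ≤ (prodBernoulli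 w').real (openConn o' b')) → (prodBernoulli (Function.update w s(v, x) 1)).real (⋃ a ∈ A, openConn v a) * (prodBernoulli (Function.update w s(v, x) 1)).real (openConn a₀ b) ≤ (prodBernoulli (Function.update w s(v, x) 1)).real (openConn v b) := by
  intro w A b v x a₀ hcard _hvA hvx _hw0 ha₀ hmin _hIH
  -- Step 1: Harris in the glued measure
  have hE : IsUpperSet (⋃ a ∈ A, openConn v a : Set (BondConfig (Fin 5))) := by
    intro ω ω' hle hω
    simp only [Set.mem_iUnion, exists_prop] at hω ⊢
    obtain ⟨a, ha, h⟩ := hω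
    exact ⟨a, ha, isUpperSet_openConn v a hle h⟩
  have hharris : (prodBernoulli (Function.update w s(v, x) 1)).real (⋃ a ∈ A, openConn v a) *
      (prodBernoulli (Function.update w s(v, x) 1)).real (openConn a₀ b) ≤
      (prodBernoulli (Function.update w s(v, x) 1)).real
        ((⋃ a ∈ A, openConn v a) ∩ openConn a₀ b) :=
    prodBernoulli_harris _ hE (isUpperSet_openConn a₀ b) MeasurableSet.of_discrete
      MeasurableSet.of_discrete
  refine hharris.trans ?_
  -- Step 2: a second relay, or none
  by_cases hA : ∃ a₁ ∈ A, a₁ ≠ a₀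
  swap
  · push Not at hA
    refine measureReal_mono fun ω hω' => ?_
    obtain ⟨hω, hab⟩ := hω'
    simp only [Set.mem_iUnion, exists_prop] at hω
    obtain ⟨a, ha, hva⟩ := hω
    rw [hA a ha] at hva
    exact SimpleGraph.Reachable.trans hva hab
  obtain ⟨a₁, ha₁, h10⟩ := hA
  have hAsub : ∀ a ∈ A, a = a₀ ∨ a = a₁ := by
    intro a ha
    by_contra h
    push Not at h
    have hnot : a ∉ ({a₀, a₁} : Finset (Fin 5)) := by
      simp only [Finset.mem_insert, Finset.mem_singleton, not_or]
      exact ⟨h.1, h.2⟩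
    have h3 : ({a, a₀, a₁} : Finset (Fin 5)).card = 3 := by
      rw [Finset.card_insert_of_notMem hnot, Finset.card_pair h10.symm]
    have hsub : ({a, a₀, a₁} : Finset (Fin 5)) ⊆ A := by
      intro z hz
      simp only [Finset.mem_insert, Finset.mem_singleton] at hz
      rcases hz with rfl | rfl | rfl <;> assumption
    have := Finset.card_le_card hsub
    omega
  -- the exchange event
  have hsplit : ((⋃ a ∈ A, openConn v a) ∩ openConn a₀ b : Set (BondConfig (Fin 5))) ⊆
      (openConn v b ∩ openConn v a₀) ∪
        (openConn v a₁ ∩ (openConn v a₀)ᶜ ∩ openConn a₀ b) := by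
    rintro ω ⟨hω, hab⟩
    simp only [Set.mem_iUnion, exists_prop] at hω
    obtain ⟨a, ha, hva⟩ := hω
    by_cases h0 : ω ∈ openConn v a₀
    · exact Or.inl ⟨SimpleGraph.Reachable.trans h0 hab, h0⟩
    · rcases hAsub a ha with rfl | rfl
      · exact absurd hva h0
      · exact Or.inr ⟨⟨hva, h0⟩, hab⟩
  -- Step 3: the key exchange inequality, transported to `P_w`
  have hkey : (prodBernoulli (Function.update w s(v, x) 1)).real
        (openConn v a₁ ∩ (openConn v a₀)ᶜ ∩ openConn a₀ b) ≤
      (prodBernoulli (Function.update w s(v, x) 1)).real (openConn v b \ openConn v a₀) := by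
    -- gluing `S = {v, x}` is `w[s(v,x) ↦ 1]`
    have hglue : (fun e : Sym2 (Fin 5) =>
        if (∀ y ∈ e, y ∈ ({v, x} : Finset (Fin 5))) ∧ ¬ e.IsDiag then (1 : unitInterval)
        else w e) = Function.update w s(v, x) 1 := by
      funext e
      induction e using Sym2.ind with
      | h p q =>
        by_cases hpq : s(p, q) = s(v, x)
        · rw [hpq, Function.update_self, if_pos]
          refine ⟨fun y hy => ?_, fun hd => hvx (Sym2.mk_isDiag_iff.1 hd)⟩
          rcases Sym2.mem_iff.1 hy with rfl | rfl <;> simp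
        · rw [Function.update_of_ne hpq, if_neg]
          rintro ⟨hmem, hdiag⟩
          have hp := hmem p (Sym2.mem_mk_left p q)
          have hq := hmem q (Sym2.mem_mk_right p q)
          have hne : p ≠ q := fun h => hdiag (Sym2.mk_isDiag_iff.2 h)
          simp only [Finset.mem_insert, Finset.mem_singleton] at hp hq
          apply hpq
          rcases hp with rfl | rfl <;> rcases hq with rfl | rfl
          · exact absurd rfl hne
          · rfl
          · exact Sym2.eq_swap
          · exact absurd rfl hne
    -- transport of masses along `ω ↦ ω ∪ D`
    have htrans : ∀ E' : Set (BondConfig (Fin 5)),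
        (prodBernoulli (Function.update w s(v, x) 1)).real E' =
          (prodBernoulli w).real
            {ω | (ω ∪ {e | (∀ y ∈ e, y ∈ ({v, x} : Finset (Fin 5))) ∧ ¬ e.IsDiag}) ∈ E'} := by
      intro E'
      rw [← hglue]
      exact stub_gluePushforward 5 w {v, x} E'
    -- the glued cluster of `v` is `K = C(v) ∪ C(x)`
    have hreachV : ∀ (ω : BondConfig (Fin 5)) (z : Fin 5),
        (ω ∪ {e | (∀ y ∈ e, y ∈ ({v, x} : Finset (Fin 5))) ∧ ¬ e.IsDiag}) ∈ openConn v z ↔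
          ∃ o ∈ ({v, x} : Finset (Fin 5)), (openGraph ω).Reachable o z := by
      intro ω z
      rw [stub_glueReach 5 {v, x} ω v z]
      constructor
      · rintro (h | ⟨_, ⟨o, ho, hoz⟩⟩)
        · exact ⟨v, by simp, h⟩
        · exact ⟨o, ho, hoz⟩
      · rintro ⟨o, ho, hoz⟩
        exact Or.inr ⟨⟨v, by simp, (SimpleGraph.Reachable.refl v : ω ∈ openConn v v)⟩,
          ⟨o, ho, hoz⟩⟩
    -- off `{a₀ ∈ K}` the event `{a₀ ↔ b}` is unchanged by the gluing
    have hreachA : ∀ ω : BondConfig (Fin 5),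
        (¬ ∃ o ∈ ({v, x} : Finset (Fin 5)), (openGraph ω).Reachable o a₀) →
        ((ω ∪ {e | (∀ y ∈ e, y ∈ ({v, x} : Finset (Fin 5))) ∧ ¬ e.IsDiag}) ∈ openConn a₀ b ↔
          ω ∈ openConn a₀ b) := by
      intro ω hno
      rw [stub_glueReach 5 {v, x} ω a₀ b]
      constructor
      · rintro (h | ⟨⟨o, ho, hao⟩, _⟩)
        · exact h
        · exact absurd ⟨o, ho, SimpleGraph.Reachable.symm hao⟩ hno
      · exact fun h => Or.inl h
    have hmemK : ∀ (ω : BondConfig (Fin 5)) (z : Fin 5),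
        (z ∈ ⋃ o ∈ ({v, x} : Finset (Fin 5)), openCluster ω o) ↔
          ∃ o ∈ ({v, x} : Finset (Fin 5)), (openGraph ω).Reachable o z := by
      intro ω z
      simp only [Set.mem_iUnion, exists_prop]
      exact Iff.rfl
    -- (i) the transported exchange event is `{a₀ ↔ b} ∩ Q`
    have hsub1 : {ω : BondConfig (Fin 5) |
        (ω ∪ {e | (∀ y ∈ e, y ∈ ({v, x} : Finset (Fin 5))) ∧ ¬ e.IsDiag}) ∈
          openConn v a₁ ∩ (openConn v a₀)ᶜ ∩ openConn a₀ b} ⊆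
        openConn a₀ b ∩ {ω | (⋃ o ∈ ({v, x} : Finset (Fin 5)), openCluster ω o) ∈
          {K : Set (Fin 5) | a₁ ∈ K ∧ a₀ ∉ K}} := by
      rintro ω ⟨⟨h1, h0⟩, hab⟩
      have h0' : ¬ ∃ o ∈ ({v, x} : Finset (Fin 5)), (openGraph ω).Reachable o a₀ :=
        fun h => h0 ((hreachV ω a₀).2 h)
      refine ⟨(hreachA ω h0').1 hab, ?_, ?_⟩
      · exact (hmemK ω a₁).2 ((hreachV ω a₁).1 h1)
      · exact fun h => h0' ((hmemK ω a₀).1 h)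
    -- (ii) `{a₁ ↔ b} ∩ Q` transports into `{v ↔ b} ∖ {v ↔ a₀}`
    have hsub2 : openConn a₁ b ∩ {ω | (⋃ o ∈ ({v, x} : Finset (Fin 5)), openCluster ω o) ∈
          {K : Set (Fin 5) | a₁ ∈ K ∧ a₀ ∉ K}} ⊆
        {ω : BondConfig (Fin 5) |
          (ω ∪ {e | (∀ y ∈ e, y ∈ ({v, x} : Finset (Fin 5))) ∧ ¬ e.IsDiag}) ∈
            openConn v b \ openConn v a₀} := by
      rintro ω ⟨hab, h1, h0⟩
      obtain ⟨o, ho, hoa⟩ := (hmemK ω a₁).1 h1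
      refine ⟨(hreachV ω b).2 ⟨o, ho, hoa.trans hab⟩, fun h => h0 ?_⟩
      exact (hmemK ω a₀).2 ((hreachV ω a₀).1 h)
    -- (iii) Kozma–Nitzan Lemma 3 for the sandwich event `Q` of the observer set `{v, x}`
    have hL3 := stub_lemma3SandwichSet_sp 5 w a₀ a₁ b {v, x}
      {K : Set (Fin 5) | a₁ ∈ K ∧ a₀ ∉ K} (fun ω h1 h0 => ⟨h1, h0⟩) (fun ω h => h.2)
      (hmin a₁ ha₁)
    calc (prodBernoulli (Function.update w s(v, x) 1)).real
          (openConn v a₁ ∩ (openConn v a₀)ᶜ ∩ openConn a₀ b)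
        = (prodBernoulli w).real {ω : BondConfig (Fin 5) |
            (ω ∪ {e | (∀ y ∈ e, y ∈ ({v, x} : Finset (Fin 5))) ∧ ¬ e.IsDiag}) ∈
              openConn v a₁ ∩ (openConn v a₀)ᶜ ∩ openConn a₀ b} := htrans _
      _ ≤ (prodBernoulli w).real (openConn a₀ b ∩
            {ω | (⋃ o ∈ ({v, x} : Finset (Fin 5)), openCluster ω o) ∈
              {K : Set (Fin 5) | a₁ ∈ K ∧ a₀ ∉ K}}) := measureReal_mono hsub1
      _ ≤ (prodBernoulli w).real (openConn a₁ b ∩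
            {ω | (⋃ o ∈ ({v, x} : Finset (Fin 5)), openCluster ω o) ∈
              {K : Set (Fin 5) | a₁ ∈ K ∧ a₀ ∉ K}}) := hL3
      _ ≤ (prodBernoulli w).real {ω : BondConfig (Fin 5) |
            (ω ∪ {e | (∀ y ∈ e, y ∈ ({v, x} : Finset (Fin 5))) ∧ ¬ e.IsDiag}) ∈
              openConn v b \ openConn v a₀} := measureReal_mono hsub2
      _ = (prodBernoulli (Function.update w s(v, x) 1)).real (openConn v b \ openConn v a₀) :=
          (htrans _).symm
  -- Step 4: assemble
  calc (prodBernoulli (Function.update w s(v, x) 1)).real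
        ((⋃ a ∈ A, openConn v a) ∩ openConn a₀ b)
      ≤ (prodBernoulli (Function.update w s(v, x) 1)).real
          ((openConn v b ∩ openConn v a₀) ∪
            (openConn v a₁ ∩ (openConn v a₀)ᶜ ∩ openConn a₀ b)) := measureReal_mono hsplit
    _ ≤ (prodBernoulli (Function.update w s(v, x) 1)).real (openConn v b ∩ openConn v a₀) +
          (prodBernoulli (Function.update w s(v, x) 1)).real
            (openConn v a₁ ∩ (openConn v a₀)ᶜ ∩ openConn a₀ b) := measureReal_union_le _ _
    _ ≤ (prodBernoulli (Function.update w s(v, x) 1)).real (openConn v b ∩ openConn v a₀) +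
          (prodBernoulli (Function.update w s(v, x) 1)).real (openConn v b \ openConn v a₀) :=
        by linarith [hkey]
    _ = (prodBernoulli (Function.update w s(v, x) 1)).real (openConn v b) :=
        measureReal_inter_add_sdiff MeasurableSet.of_discrete

end Summit.CriticalPhenomena.PercolationContinuityZ3.Theorems
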